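import Literature.IUT.HodgeArakelov.LabelClassesOfCuspsCor24iLevelsByName
import Literature.IUT.HodgeTheaters.TemperedCoveringsSubgraphClosures
import Literature.IUT.HodgeTheaters.TemperedCoveringsCor23iiiProofs
import HarnessLib

/-!
# [IUTchII] Cor 2.4 (i), inputs (B)+(C) over ADMISSIBLE levels: closure taken in `Π̂_𝔾`, conclusion `γ' ∈ Δ^±_{v□}` outright

S. Mochizuki, *Inter-universal Teichmüller Theory II*, kurims manuscript (Dec. 2020), §2, Cor 2.4 (i), proof p.70 l.−2 –
p.71 l.4: "by applying the equivalence of [IUTchI], Corollary 2.3, (vi) …, to the various finite index open subgroups of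
`Δ^±_v`, it follows that `γ' ∈ Δ̂^±_{v□}` — where we use the notation "∧" to denote the closure in `Δ̂^±_v` [cf. …
[IUTchI], Corollary 2.3, (ii)] — hence that `γ' ∈ Δ^±_{v□} = Δ̂^±_{v□} ∩ Δ^±_v` [cf. [IUTchI], Corollary 2.3, (v)]";
*… I*, kurims manuscript (May 2020), §2, Cor 2.3 (i) p.47 (`Δ^tp_{X,ℍ} := Δ^tp_X ×_{Π^tp_𝔾} Π^tp_ℍ`,
`Δ̂_{X,ℍ} := Δ̂_X ×_{Π̂_𝔾} Π̂_ℍ`), (ii), (v), (vi) pp.47–48 [cite: Mochizuki2012, II Cor 2.4 (i) pp.70-71] (D-0012 claim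
key, status disputed; PROOF-ONLY — no definition, nothing of the series asserted; abc-iut cell, seat abc-iut-w5-d121;
node `IUTchII:Cor2.4(i)` inputs (B) = GAP-LEDGER G-w4d012-2 and (C); sub-DAG `plan/L5/SUBDAG-IUTchI-Cor23Levels.md`).

WHY THIS VARIANT.  `LabelClassesOfCuspsCor24iLevelsAssembly` / `…ByName` (p419450 / p420168) supply (B) from level data
whose levels `Ĵ_i ⊆ Π̂_{X_v}` must SHRINK TO `1` in `Π̂_{X_v}` (`hbasis'`), i.e. the tower must contain NON-admissible
coverings of `X_v` — for which "the inverse image of `□` in the dual graph of the level-`i` covering" (abc-iut-w4-d076's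
`CoveringLevelGraphs.proj`) is delicate (components of the stable model of a non-admissible covering may specialise to
nodes).  The printed conclusion does not need them: `Δ^tp_{X,ℍ} ⊇ Ker(Δ^tp_X ↠ Π^tp_𝔾)` and `Δ̂^±_{v□} = Δ̂_{X,ℍ} =
Δ̂_X ×_{Π̂_𝔾} Π̂_ℍ` ([IUTchI] Cor 2.3 (i)/(ii)), so it suffices that the IMAGES of the levels shrink to `1` **in `Π̂_𝔾`** —
true for the ADMISSIBLE levels alone (the finite étale coverings of the semi-graph of anabelioids `𝔾`, [SemiAnbd]), where
the level graphs ARE coverings of `𝔾` with deck transformations.  This file proves that route: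
* § 1 `StableCurveTemperedData.mem_deltaTpH_of_graphLevels` — pure topology in `Π̂_𝔾` (abc-iut-w5-d121's
  `mem_closure_of_forall_level`) + `Π̂_ℍ` closed + [IUTchI] Cor 2.3 (v) (abc-iut-L5-t1's `Cor23v`): per-level statements
  "`γ ∈ Δ^tp_{X,ℍ}·J_i`" over levels whose images shrink to `1` in `Π̂_𝔾` give `γ ∈ Δ^tp_{X,ℍ}` OUTRIGHT ((B) and (C) fused,
  exactly print's "hence `γ' ∈ Δ^±_{v□} = Δ̂^±_{v□} ∩ Δ^±_v`");
* § 2 `StableCurveAgreement.levelStatement_of_subgraphLevelData` (the per-level statement for the node's finite-index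
  `I_t`, extracted from the plumbing of p419450) and **`StableCurveAgreement.mem_deltaPmBox_of_subgraphLevelData`** /
  `…_of_coveringLevelGraphs`: `γ' ∈ Δ^±_{v□}` from the B13 agreement + `Δ`-dictionary, abc-iut-L5-t11's level predicates
  (`LevelsNormal`, `LevelIncidence` or Cor 2.3 (vi) BY NAME via `LevelDatum`, `IsBlock` or abc-iut-w4-d076's realisation,
  `StabLeDeltaHLevel`), the levels' images shrinking in `Π̂_𝔾` (`hU`), `Π̂_ℍ` closed, `Cor23v`, tower placement
  (`hlevV`, `hinf`), Def 2.3 (ii)′ — NO `Cor23ii`, NO profiniteness of `Π̂_{X_v}`, NO `DeltaHatClosed/LevelsInDelta/LevelsCofinal`;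
* § 3 the closers `cor24_i_of_inputs_mem`, **`cor24_i'_of_graphLevels_byName`**, **`cor24_ii_iii'_of_graphLevels_byName`**.
PROVED (kernel); every [IUTchI]/[IUTchII] statement is a HYPOTHESIS; typed ≠ proved; nothing here bears on [IUTchIII] Cor 3.12.
-/

universe u

/-! ## § 1. Closure in `Π̂_𝔾` and Cor 2.3 (v) -/

namespace Literature.IUT.HodgeTheaters

open Topology
open scoped Pointwise

namespace StableCurveTemperedData

variable {D : StableCurveTemperedData.{u}}

/-- **IUTchII:Cor2.4(i)** (kurims p.71 l.1–4) with **IUTchI:Cor2.3(i)/(v)** (pp.47–48): let `U_i ⊆ Π̂_𝔾` be subgroups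
shrinking to `1` ("the various finite index open subgroups" read in `Π̂_𝔾`, i.e. over the ADMISSIBLE coverings) and
`γ ∈ Δ^tp_X` such that, at every level, `γ ∈ Δ^tp_{X,ℍ} · J_i` with `ι(ρ^tp(J_i)) ⊆ U_i`; then — `Π̂_ℍ ⊆ Π̂_𝔾` being closed
and `Δ̂_{X,ℍ} ∩ Δ^tp_X = Δ^tp_{X,ℍ}` (Cor 2.3 (v), HYPOTHESIS `Cor23v`) — `γ ∈ Δ^tp_{X,ℍ}`: the image of `γ` in `Π̂_𝔾` lies
in `Π̂_ℍ · U_i` for all `i`, hence in the closure of `Π̂_ℍ`, hence in `Π̂_ℍ`, so `γ ∈ Δ̂_{X,ℍ} ∩ Δ^tp_X`.  PROVED.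
[claim: Mochizuki2012, status: disputed] -/
theorem mem_deltaTpH_of_graphLevels (h23v : D.Cor23v) (hH : IsClosed (D.graph.HatH : Set D.graph.Hat))
    {ι : Sort*} (U : ι → Subgroup D.graph.Hat)
    (hU : ∀ O ∈ 𝓝 (1 : D.graph.Hat), ∃ i, (U i : Set D.graph.Hat) ⊆ O) (γ : D.DeltaTp)
    (hlev : ∀ i, ∃ k ∈ D.deltaTpH, D.graph.ι (D.ρTp (k⁻¹ * γ)) ∈ U i) : γ ∈ D.deltaTpH := by
  -- `ι(ρ^tp γ)` lies in `Π̂_ℍ · U_i` for every `i`, hence in the closure of `Π̂_ℍ`, which is `Π̂_ℍ`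
  have hx : D.graph.ι (D.ρTp γ) ∈ closure (D.graph.HatH : Set D.graph.Hat) := by
    refine Literature.IUT.HodgeArakelov.mem_closure_of_forall_level U hU D.graph.HatH fun i => ?_
    obtain ⟨k, hk, hkU⟩ := hlev i
    refine ⟨D.graph.ι (D.ρTp k), D.graph.tpH_le ⟨D.ρTp k, hk, rfl⟩, ?_⟩
    simpa only [map_mul, map_inv] using hkU
  rw [hH.closure_eq] at hx
  -- so `ι_Δ γ ∈ Δ̂_{X,ℍ} ∩ ι_Δ(Δ^tp_X) = ι_Δ(Δ^tp_{X,ℍ})` (Cor 2.3 (v))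
  have h1 : D.ιΔ γ ∈ D.deltaHatH := by
    show D.ρHat (D.ιΔ γ) ∈ D.graph.HatH
    rw [D.ρHat_ιΔ]
    exact hx
  have h2 : D.ιΔ γ ∈ D.deltaHatH ⊓ D.ιΔ.range := ⟨h1, γ, rfl⟩
  rw [h23v.inf_eq] at h2
  obtain ⟨d, hd, hdγ⟩ := h2
  rw [← D.ιΔ_injective hdγ]
  exact hd

end StableCurveTemperedData

end Literature.IUT.HodgeTheaters

/-! ## § 2. `γ' ∈ Δ^±_{v□}` from the level data, through the agreement -/

namespace Literature.IUT.HodgeArakelov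

open Literature.IUT.HodgeTheaters Topology
open Literature.AnabelianGeometry.SemiGraphs (IsProSigma)
open scoped Pointwise

namespace PlusMinusTower

namespace StableCurveAgreement

variable {S : BadPlaceSetting.{u}} {P : TopGroup.{u}} {T : TemperedCoverings S P}
  {W : PlusMinusTower T} {C : CuspidalInertiaData W} {D : StableCurveTemperedData.{u}}

/-- **IUTchII:Cor2.4(i)** (kurims p.70 l.−2 – p.71 l.3, ONE level) **The per-level statement for the node's `I_t`**
(the plumbing of `h23vi_of_subgraphLevelData`, p419450, exposed): under the B13 agreement with `Δ`-dictionary, a tower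
with level subgraph data satisfying `LevelsNormal`, `LevelIncidence`, `IsBlock`, `StabLeDeltaHLevel`, levels below
`Π̂_v` (`hlevV`) with `Π^±_v ∩ Π̂_v ⊆ Π_v` (`hinf`), Def 2.3 (ii)′, and `I_t ⊆ Δ_{v□}` cuspidal in `Π_v`: for `γ' ∈ Δ^±_v`
with `I^{γ'}_t ⊆ Π^±_{v□}` and `γ ∈ Δ^tp_X` with `ι(γ) = ê(γ')`, at every level `i` there is `k ∈ Δ^tp_{X,ℍ}` with
`k⁻¹ γ ∈ J_i`.  PROVED (via `levelTarget_sub_hat`). [claim: Mochizuki2012, status: disputed] -/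
theorem levelStatement_of_subgraphLevelData (A : StableCurveAgreement W C D) {H : Subgroup P}
    (Dic : A.SubgraphDictionary H) (Tw : D.Prop24Tower) (Lv : Tw.SubgraphLevelData) (hN : Tw.LevelsNormal)
    (hinc : Lv.LevelIncidence) (hblk : Lv.IsBlock) (hstab : Lv.StabLeDeltaHLevel)
    (hlevV : ∀ i, Tw.Jhat i ≤ (W.hat.subgroupOf W.pmHat).map A.eHat.toMonoidHom)
    (hinf : W.piPM ⊓ W.hat ≤ W.piV) (hrel' : Def23_ii' C W.piV W.piPM) {I : Subgroup W.Corhat}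
    (hI : C.IsCuspidalInertia W.piV I) (hIΔ : I ≤ W.deltaBox H)
    {γ' : W.Corhat} (hγ' : γ' ∈ W.piPM ⊓ W.aug.ker) (hc : I.map (MulAut.conj γ').toMonoidHom ≤ W.pmBox H)
    (hγ'pm : γ' ∈ W.pmHat) (γ : D.DeltaTp) (hγ : D.ιX (γ : D.PiTp) = A.eHat ⟨γ', hγ'pm⟩) (i : Tw.I) :
    ∃ k ∈ D.deltaTpH, k⁻¹ * γ ∈ D.levelTp (Tw.Jhat i) := by
  obtain ⟨I', hI', -, hII'⟩ := (hrel'.2.1 I).mp hI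
  obtain ⟨hI'pm, x, t, hK⟩ := (A.inertia_iff I').mp hI'
  obtain ⟨hγ'pm', hγ'ker⟩ := Subgroup.mem_inf.mp hγ'
  set g' : D.PiHat := A.eHat ⟨γ', hγ'pm⟩ with hg'
  have hg'tp : g' ∈ D.ιX.range := (A.mem_piPM_iff ⟨γ', hγ'pm⟩).mp hγ'pm'
  have hg'Δ : g' ∈ D.DeltaHat := (A.mem_ker_iff ⟨γ', hγ'pm⟩).mp hγ'ker
  set J : Subgroup D.PiHat := (I.subgroupOf W.pmHat).map A.eHat.toMonoidHom with hJ
  have dic : ∀ q : W.pmHat, (q : W.Corhat) ∈ W.deltaPmBox H →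
      A.eHat q ∈ (D.deltaTpH.map D.ιΔ).map D.DeltaHat.subtype := by
    intro q hq
    rw [← Dic.deltaPmBox_eq]
    exact ⟨q, Subgroup.mem_subgroupOf.mpr hq, rfl⟩
  have hIΔ' : I ≤ W.deltaPmBox H := hIΔ.trans (W.deltaBox_le_deltaPmBox H)
  -- (1) the level-`i` inertia group of the cusp `t·x̃` lies in `J`
  have h1 : (MulAut.conj t • ((D.inertiaTp x).map D.DeltaTp.subtype)).map D.ιX ⊓ Tw.Jhat i ≤ J := by
    rintro y ⟨hy1, hy2⟩
    rw [← hK] at hy1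
    obtain ⟨q, hq, rfl⟩ := hy1
    have hqI' : (q : W.Corhat) ∈ I' := Subgroup.mem_subgroupOf.mp hq
    obtain ⟨q₁, hq₁, hqq₁⟩ := hlevV i hy2
    rw [MulEquiv.coe_toMonoidHom, A.eHat.apply_eq_iff_eq] at hqq₁
    subst hqq₁
    have hqV : (q₁ : W.Corhat) ∈ W.piV := hinf ⟨hI'pm hqI', Subgroup.mem_subgroupOf.mp hq₁⟩
    refine ⟨q₁, Subgroup.mem_subgroupOf.mpr ?_, rfl⟩
    rw [hII']
    exact ⟨hqI', hqV⟩
  -- (2) `J ⊆ ι(Δ^tp_{X,ℍ})`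
  have h2 : J ≤ (D.deltaTpH.map D.ιΔ).map D.DeltaHat.subtype := by
    rintro _ ⟨q, hq, rfl⟩
    exact dic q (hIΔ' (Subgroup.mem_subgroupOf.mp hq))
  -- (3) `J^{g'} ⊆ ι(Δ^tp_{X,ℍ})`
  have hcs : MulAut.conj γ' • I ≤ W.pmBox H := by rw [← map_conj_eq_smul]; exact hc
  have h3 : MulAut.conj g' • J ≤ (D.deltaTpH.map D.ιΔ).map D.DeltaHat.subtype := by
    rw [hJ, hg', ← map_subgroupOf_conj A.eHat I hγ'pm]
    rintro _ ⟨q, hq, rfl⟩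
    have hq' : (q : W.Corhat) ∈ MulAut.conj γ' • I := Subgroup.mem_subgroupOf.mp hq
    refine dic q (Subgroup.mem_inf.mpr ⟨hcs hq', ?_⟩)
    have hz : (MulAut.conj γ')⁻¹ • (q : W.Corhat) ∈ W.aug.ker :=
      (Subgroup.mem_inf.mp (hIΔ' (Subgroup.mem_pointwise_smul_iff_inv_smul_mem.mp hq'))).2
    rw [MulAut.smul_def, MulAut.conj_inv_apply] at hz
    have e : (q : W.Corhat) = γ' * (γ'⁻¹ * q * γ') * γ'⁻¹ := by group
    rw [e]
    exact W.aug.ker.mul_mem (W.aug.ker.mul_mem hγ'ker hz) (W.aug.ker.inv_mem hγ'ker)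
  obtain ⟨k', hk', hkU⟩ := Lv.levelTarget_sub_hat hN hinc hblk hstab i x t J h1 h2 hg'tp hg'Δ h3
  -- read `k' ∈ ι(Δ^tp_{X,ℍ})`, `k'⁻¹ g' ∈ Ĵ_i` back in `Δ^tp_X`
  obtain ⟨_, ⟨k, hk, rfl⟩, rfl⟩ := hk'
  refine ⟨k, hk, (D.mem_levelTp).mpr ?_⟩
  have e2 : D.ιX ((k⁻¹ * γ : D.DeltaTp) : D.PiTp) = (D.DeltaHat.subtype (D.ιΔ k))⁻¹ * g' := by
    rw [Subgroup.coe_mul, Subgroup.coe_inv, map_mul, map_inv, hγ]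
    rfl
  rw [e2]
  exact hkU

/-- **IUTchII:Cor2.4(i)** (kurims p.70 l.−2 – p.71 l.4) **Inputs (B)+(C) over admissible levels: `γ' ∈ Δ^±_{v□}`
outright.**  HYPOTHESES (named, none asserted): the B13 agreement `A` + `Δ`-dictionary `Dic` of the target `Π_{v□}`;
a tower with level subgraph data and the predicates `LevelsNormal`, `LevelIncidence`, `IsBlock`, `StabLeDeltaHLevel`
(abc-iut-L5-t11); the IMAGES of the levels shrink to `1` in `Π̂_𝔾` (`hU` — the admissible coverings are cofinal THERE);
`Π̂_ℍ ⊆ Π̂_𝔾` closed (`hHatH`); [IUTchI] Cor 2.3 (v) (`Cor23v`); levels below `Π̂_v` (`hlevV`), `Π^±_v ∩ Π̂_v ⊆ Π_v`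
(`hinf`); Def 2.3 (ii)′; `I_t ⊆ Δ_{v□}` cuspidal in `Π_v`.  CONCLUSION: for `γ' ∈ Δ^±_v`, `I^{γ'}_t ⊆ Π^±_{v□} ⟹
γ' ∈ Δ^±_{v□}`.  PROVED (`levelStatement_of_subgraphLevelData` at every level, `mem_deltaTpH_of_graphLevels`, and the
dictionary read backwards). [claim: Mochizuki2012, status: disputed] -/
theorem mem_deltaPmBox_of_subgraphLevelData (A : StableCurveAgreement W C D) {H : Subgroup P}
    (Dic : A.SubgraphDictionary H) (Tw : D.Prop24Tower) (Lv : Tw.SubgraphLevelData) (hN : Tw.LevelsNormal)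
    (hinc : Lv.LevelIncidence) (hblk : Lv.IsBlock) (hstab : Lv.StabLeDeltaHLevel)
    (hU : ∀ O ∈ 𝓝 (1 : D.graph.Hat), ∃ i, ∀ d ∈ D.levelTp (Tw.Jhat i), D.graph.ι (D.ρTp d) ∈ O)
    (hHatH : IsClosed (D.graph.HatH : Set D.graph.Hat)) (h23vD : D.Cor23v)
    (hlevV : ∀ i, Tw.Jhat i ≤ (W.hat.subgroupOf W.pmHat).map A.eHat.toMonoidHom)
    (hinf : W.piPM ⊓ W.hat ≤ W.piV) (hrel' : Def23_ii' C W.piV W.piPM) {I : Subgroup W.Corhat}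
    (hI : C.IsCuspidalInertia W.piV I) (hIΔ : I ≤ W.deltaBox H) :
    ∀ γ' : W.Corhat, γ' ∈ W.piPM ⊓ W.aug.ker →
      I.map (MulAut.conj γ').toMonoidHom ≤ W.pmBox H → γ' ∈ W.deltaPmBox H := by
  intro γ' hγ' hc
  obtain ⟨hγ'pm', hγ'ker⟩ := Subgroup.mem_inf.mp hγ'
  have hγ'pm : γ' ∈ W.pmHat := W.emb_le_pmHat hγ'pm'
  obtain ⟨γ, hγ⟩ := StableCurveTemperedData.exists_deltaTp_of_mem_range_of_mem_deltaHat
    ((A.mem_piPM_iff ⟨γ', hγ'pm⟩).mp hγ'pm') ((A.mem_ker_iff ⟨γ', hγ'pm⟩).mp hγ'ker)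
  -- `γ ∈ Δ^tp_{X,ℍ}` by § 1 over the images of the levels in `Π̂_𝔾`
  have hγH : γ ∈ D.deltaTpH := by
    refine StableCurveTemperedData.mem_deltaTpH_of_graphLevels h23vD hHatH
      (fun i => (D.levelTp (Tw.Jhat i)).map (D.graph.ι.comp D.ρTp)) (fun O hO => ?_) γ (fun i => ?_)
    · obtain ⟨i, hi⟩ := hU O hO
      refine ⟨i, ?_⟩
      rintro _ ⟨d, hd, rfl⟩
      exact hi d hd
    · obtain ⟨k, hk, hj⟩ := A.levelStatement_of_subgraphLevelData Dic Tw Lv hN hinc hblk hstab hlevV hinf hrel'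
        hI hIΔ hγ' hc hγ'pm γ hγ i
      exact ⟨k, hk, ⟨k⁻¹ * γ, hj, rfl⟩⟩
  -- read `γ ∈ Δ^tp_{X,ℍ}` back through the dictionary: `γ' ∈ Δ^±_{v□}`
  have hmem : A.eHat ⟨γ', hγ'pm⟩ ∈ ((W.deltaPmBox H).subgroupOf W.pmHat).map A.eHat.toMonoidHom := by
    rw [Dic.deltaPmBox_eq, ← hγ]
    exact ⟨D.ιΔ γ, ⟨γ, hγH, rfl⟩, rfl⟩
  obtain ⟨q, hq, hqe⟩ := hmem
  rw [MulEquiv.coe_toMonoidHom, A.eHat.apply_eq_iff_eq] at hqe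
  have : (q : W.Corhat) = γ' := congrArg Subtype.val hqe
  rw [← this]
  exact Subgroup.mem_subgroupOf.mp hq

/-- **IUTchII:Cor2.4(i)** (kurims pp.70–71) The same with [IUTchI] Cor 2.3 (vi) BY NAME at every level (abc-iut-L5-t11's
`LevelDatum` + `Cor23vi`) and the B4 core discharged by abc-iut-w4-d076's semi-graph-covering realisation
(`CoveringLevelGraphs`, `toLevelData_isBlock`) — the realisation is EXACTLY right for admissible levels. PROVED.
[claim: Mochizuki2012, status: disputed] -/
theorem mem_deltaPmBox_of_coveringLevelGraphs (A : StableCurveAgreement W C D) {H : Subgroup P}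
    (Dic : A.SubgraphDictionary H) (Tw : D.Prop24Tower) (Cv : Tw.CoveringLevelGraphs)
    (Ad : ∀ i, Cv.toLevelData.LevelDatum i) (h23vi : ∀ i, (Ad i).lev.Cor23vi) (hN : Tw.LevelsNormal)
    (hstab : Cv.toLevelData.StabLeDeltaHLevel)
    (hU : ∀ O ∈ 𝓝 (1 : D.graph.Hat), ∃ i, ∀ d ∈ D.levelTp (Tw.Jhat i), D.graph.ι (D.ρTp d) ∈ O)
    (hHatH : IsClosed (D.graph.HatH : Set D.graph.Hat)) (h23vD : D.Cor23v)
    (hlevV : ∀ i, Tw.Jhat i ≤ (W.hat.subgroupOf W.pmHat).map A.eHat.toMonoidHom)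
    (hinf : W.piPM ⊓ W.hat ≤ W.piV) (hrel' : Def23_ii' C W.piV W.piPM) {I : Subgroup W.Corhat}
    (hI : C.IsCuspidalInertia W.piV I) (hIΔ : I ≤ W.deltaBox H) :
    ∀ γ' : W.Corhat, γ' ∈ W.piPM ⊓ W.aug.ker →
      I.map (MulAut.conj γ').toMonoidHom ≤ W.pmBox H → γ' ∈ W.deltaPmBox H :=
  A.mem_deltaPmBox_of_subgraphLevelData Dic Tw Cv.toLevelData hN (Cv.toLevelData.levelIncidence_of_cor23vi Ad h23vi)
    Cv.toLevelData_isBlock hstab hU hHatH h23vD hlevV hinf hrel' hI hIΔ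

end StableCurveAgreement

end PlusMinusTower

/-! ## § 3. The closers -/

section ClosersGraph

open Literature.IUT.HodgeTheaters Topology
open Literature.AnabelianGeometry.SemiGraphs (IsProSigma)

variable {S : BadPlaceSetting.{u}} {P : TopGroup.{u}} {T : TemperedCoverings S P}

/-- **IUTchII:Cor2.4(i)** (kurims pp.69–71) `Cor24_i W C H I` from input (A) ([IUTchI] Cor 2.5 at the tower, `h25`) and the
FUSED inputs (B)+(C) — "`I^{γ'}_t ⊆ Π^±_{v□} ⟹ γ' ∈ Δ^±_{v□}` for `γ' ∈ Δ^±_v`" (`hBC`) — both allowed to use the printed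
hypotheses on `I_t`; HYPOTHESES.  PROVED (via `cor24_i_iff_c_imp_a`). [claim: Mochizuki2012, status: disputed] -/
theorem cor24_i_of_inputs_mem (W : PlusMinusTower T) (C : CuspidalInertiaData W) (H : Subgroup P)
    (I : Subgroup W.Corhat)
    (h25 : C.IsCuspidalInertia W.piV I → I ≤ W.deltaBox H →
      ∀ γ' : W.Corhat, γ' ∈ W.pmHat ⊓ W.aug.ker →
        I.map (MulAut.conj γ').toMonoidHom ≤ W.piPM → γ' ∈ W.piPM)
    (hBC : C.IsCuspidalInertia W.piV I → I ≤ W.deltaBox H →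
      ∀ γ' : W.Corhat, γ' ∈ W.piPM ⊓ W.aug.ker →
        I.map (MulAut.conj γ').toMonoidHom ≤ W.pmBox H → γ' ∈ W.deltaPmBox H) :
    Literature.IUT.HodgeArakelov.Cor24_i W C H I := by
  rw [cor24_i_iff_c_imp_a]
  intro hI hIΔ γ' hγ' hc
  have hpm : γ' ∈ W.piPM := h25 hI hIΔ γ' hγ' (hc.trans (W.pmNormalizer_le_piPM H))
  have hΔ : γ' ∈ W.piPM ⊓ W.aug.ker := Subgroup.mem_inf.mpr ⟨hpm, (Subgroup.mem_inf.mp hγ').2⟩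
  exact (Subgroup.mem_inf.mp (hBC hI hIΔ γ' hΔ hc)).1

variable {D : EtaleThetaData S.toThetaSetting P} {Dsc : StableCurveTemperedData.{u}}
  (Dec : SubgraphDecomposition S T D) (W : PlusMinusTower T) (C : CuspidalInertiaData W)
  {L : LabCuspStructure C} (Ld : LabelledDecomposition Dec L) (I : Subgroup W.Corhat)

/-- **IUTchII:Cor2.4(i)′ — closer over ADMISSIBLE level data, Cor 2.3 (vi) BY NAME** (kurims pp.69–71): the decl of
record `Cor24_i' Dec W C Ld I` from the agreement `A` with [IUTchI] Prop 2.4 (i), [IUTchII] Def 2.3 (ii)′, `e : I_x ≃ₜ* Ẑ`,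
`Π^±_v ∩ Π̂_v ⊆ Π_v`, and, per admissible `Π_{v□}` (`GraphLevels`): an [IUTchI] §2 datum `D'` with agreement `A'` and
`Δ`-dictionary, Cor 2.3 (v) for `D'`, `Π̂_ℍ` closed in `Π̂_𝔾`, a tower realised by coverings of semi-graphs whose level data
satisfy Cor 2.3 (vi) (`Cor23vi`) BY NAME, `StabLeDeltaHLevel`, `LevelsNormal`, level images shrinking to `1` in `Π̂_𝔾`,
levels below `Π̂_v`.  NO `Cor23ii`, NO profiniteness/cofinality in `Π̂_{X_v}`.  ALL HYPOTHESES.  PROVED.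
[claim: Mochizuki2012, status: disputed] -/
theorem cor24_i'_of_graphLevels_byName (A : W.StableCurveAgreement C Dsc) (h24i : Dsc.Prop24i)
    (hrel' : Def23_ii' C W.piV W.piPM) (e : ∀ x : Dsc.Cusp, ↥(Dsc.inertiaTp x) ≃ₜ* HodgeTheaters.ZHat)
    (hinf : W.piPM ⊓ W.hat ≤ W.piV)
    (GraphLevels : ∀ H : Subgroup P, Cor24_family Dec Ld H →
      ∃ (D' : StableCurveTemperedData.{u}) (A' : W.StableCurveAgreement C D') (_ : A'.SubgraphDictionary H)
        (_ : D'.Cor23v) (_ : IsClosed (D'.graph.HatH : Set D'.graph.Hat))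
        (Tw : D'.Prop24Tower) (Cv : Tw.CoveringLevelGraphs) (Ad : ∀ i, Cv.toLevelData.LevelDatum i),
        (∀ i, (Ad i).lev.Cor23vi) ∧ Tw.LevelsNormal ∧ Cv.toLevelData.StabLeDeltaHLevel ∧
        (∀ O ∈ 𝓝 (1 : D'.graph.Hat), ∃ i, ∀ d ∈ D'.levelTp (Tw.Jhat i), D'.graph.ι (D'.ρTp d) ∈ O) ∧
        (∀ i, Tw.Jhat i ≤ (W.hat.subgroupOf W.pmHat).map A'.eHat.toMonoidHom)) :
    Literature.IUT.HodgeArakelov.Cor24_i' Dec W C Ld I :=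
  fun H hH => cor24_i_of_inputs_mem W C H I
    (fun hI hIΔ => A.inputA_of_prop24i h24i (hIΔ.trans (inf_le_right : W.deltaBox H ≤ W.aug.ker))
      (A.hΛ_of_equiv_zHat_of_def23ii' hrel' e I hI))
    (fun hI hIΔ => by
      obtain ⟨D', A', hDic, h23vD, hHatH, Tw, Cv, Ad, h23vi, hN, hstab, hU, hlevV⟩ := GraphLevels H hH
      exact A'.mem_deltaPmBox_of_coveringLevelGraphs hDic Tw Cv Ad h23vi hN hstab hU hHatH h23vD hlevV hinf hrel'
        hI hIΔ)

/-- **IUTchII:Cor2.4(ii)(iii)′ — closer over ADMISSIBLE level data, Cor 2.3 (vi) BY NAME** (kurims p.70): the decl of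
record `Cor24_ii_iii' W C H` for an admissible `Π_{v□}` with input (B)+(C) supplied per `□'` by `GraphLevels` as in
`cor24_i'_of_graphLevels_byName`; other inputs (`Prop24i`, `Cor23Hyp`, `Cor23iii`, `hBox`, `Def23_ii'`, `e`, `hinf`, `hcap`,
`hYdd`) as in the landed closers — ALL HYPOTHESES.  PROVED. [claim: Mochizuki2012, status: disputed] -/
theorem cor24_ii_iii'_of_graphLevels_byName {H : Subgroup P} (hH : Cor24_family Dec Ld H)
    (A : W.StableCurveAgreement C Dsc) (h24i : Dsc.Prop24i) (hHyp : Dsc.Cor23Hyp) (h23iii : Dsc.Cor23iii)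
    (hrel' : Def23_ii' C W.piV W.piPM) (e : ∀ x : Dsc.Cusp, ↥(Dsc.inertiaTp x) ≃ₜ* HodgeTheaters.ZHat)
    (hinf : W.piPM ⊓ W.hat ≤ W.piV)
    (GraphLevels : ∀ H' : Subgroup P, Cor24_family Dec Ld H' →
      ∃ (D' : StableCurveTemperedData.{u}) (A' : W.StableCurveAgreement C D') (_ : A'.SubgraphDictionary H')
        (_ : D'.Cor23v) (_ : IsClosed (D'.graph.HatH : Set D'.graph.Hat))
        (Tw : D'.Prop24Tower) (Cv : Tw.CoveringLevelGraphs) (Ad : ∀ i, Cv.toLevelData.LevelDatum i),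
        (∀ i, (Ad i).lev.Cor23vi) ∧ Tw.LevelsNormal ∧ Cv.toLevelData.StabLeDeltaHLevel ∧
        (∀ O ∈ 𝓝 (1 : D'.graph.Hat), ∃ i, ∀ d ∈ D'.levelTp (Tw.Jhat i), D'.graph.ι (D'.ρTp d) ∈ O) ∧
        (∀ i, Tw.Jhat i ≤ (W.hat.subgroupOf W.pmHat).map A'.eHat.toMonoidHom))
    (hBox : ((W.pmBox H).subgroupOf W.pmHat).map A.eHat.toMonoidHom = Dsc.piTpXH.map Dsc.ιX)
    (hcap : W.pmBox H ⊓ W.piV ≤ W.box H)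
    (hYdd : ∀ I : Subgroup W.Corhat, C.IsCuspidalInertia W.piV I → I ≤ W.deltaBox H →
      W.cuspDecomp I 1 ≤ (T.YddL).map (W.emb.comp T.incl)) :
    Literature.IUT.HodgeArakelov.Cor24_ii_iii' W C H :=
  cor24_ii_iii'_of_inputs
    (fun I _ _ => cor24_i'_of_graphLevels_byName Dec W C Ld I A h24i hrel' e hinf GraphLevels H hH)
    (A.boxOntoGalois_of_cor23iii hBox hHyp h23iii) hcap hYdd

end ClosersGraph

end Literature.IUT.HodgeArakelov
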